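import Mathlib
import HarnessLib
import Literature.Probability.Moments.SampleVariance
import Literature.Probability.HeavyTails.MarcinkiewiczZygmund

/-!
# The sample variance under a finite `2p`-th moment, `1 < p < 2`: `S²_n − σ² = o(n^{1/p − 1})` a.s.

Topic `Probability/HeavyTails`; namespace `Literature.Probability.HeavyTails`.  Everything is PROVED;
no named fact, no axiom, no definition.  A COROLLARY file: the Marcinkiewicz–Zygmund strong law
[cite: Durrett2019, §2.5.1 Theorem 2.5.12] (tree: `MarcinkiewiczZygmund.lean`,
`Durrett2019_thm_2_5_12_sampleMean`) applied to the squares `X_i²` and to the `X_i` themselves, combined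
through the computational identity of the unbiased sample variance
`S²_n = (Σ_{i<n} X_i² − (Σ_{i<n} X_i)²/n)/(n − 1)` [cite: Lemieux2009, §6.2 eq. (6.1)] (tree:
`Literature.Probability.Moments.sampleVariance`).

* `sampleVariance_fin_eq` — the computational identity for the first `n ≥ 1` terms of a sequence;
* **`ae_tendsto_rpow_mul_sampleVariance_sub_variance`** — `X_0, X_1, …` i.i.d. (`iIndepFun` +
  `IdentDistrib`), measurable, `E|X_0|^{2p} < ∞` for some `1 < p < 2` ⇒
  **`n^{1 − 1/p} (S²_n − Var X_0) → 0` a.s.**: the sample variance is strongly consistent at the a.s.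
  rate `o(n^{1/p − 1})` as soon as a moment of order `2p ∈ (2, 4)` is finite — no fourth moment needed
  (contrast `Moments/SampleVarianceMoments.lean`, where `Var S²` requires `θ₄ < ∞`).  Proof:
  `S²_n − σ² = (n/(n−1))·[A_n − B_n(B_n + 2μ)] + σ²/(n−1)` with `A_n = (1/n)Σ X_i² − E X²`,
  `B_n = X̄_n − μ`, and Theorem 2.5.12 gives `n^{1−1/p} A_n → 0`, `n^{1−1/p} B_n → 0` a.s.

Context (cell pub-qed, value-free): the «se of σ̂» cells for an arm whose weights have tail index
`α ∈ (2, 4)` — finite variance, infinite fourth moment: `σ̂²` still converges a.s., at rate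
`o(n^{2/α − 1 + δ})` for every `δ > 0` (take `p < α/2`), while the CLT-type error bar OF `σ̂²`
(which needs `θ₄`) is unavailable.
-/

namespace Literature.Probability.HeavyTails

open MeasureTheory ProbabilityTheory Filter Finset
open scoped Topology
open Literature.Probability.Moments (sampleMean sampleVariance)

variable {Ω : Type*} {mΩ : MeasurableSpace Ω} {μ : Measure Ω}

omit mΩ in
/-- The computational identity of the unbiased sample variance for the first `n ≥ 1` terms of a
sequence: `S²_n = (Σ_{i<n} x_i² − (Σ_{i<n} x_i)²/n)/(n − 1)`. [cite: Lemieux2009, §6.2 eq. (6.1)] -/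
theorem sampleVariance_fin_eq (X : ℕ → Ω → ℝ) {n : ℕ} (hn : n ≠ 0) (ω : Ω) :
    sampleVariance (fun l : Fin n => X l) ω =
      ((∑ i ∈ range n, X i ω ^ 2) - (∑ i ∈ range n, X i ω) ^ 2 / n) / ((n : ℝ) - 1) := by
  have hn' : (n : ℝ) ≠ 0 := by exact_mod_cast hn
  simp only [sampleVariance, sampleMean]
  rw [Finset.sum_range (fun i => X i ω ^ 2), Finset.sum_range (fun i => X i ω)]
  congr 1
  set T := ∑ l : Fin n, X l ω with hT
  have h : ∀ l : Fin n, (X l ω - T / n) ^ 2 = X l ω ^ 2 - (2 * T / n) * X l ω + (T / n) ^ 2 :=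
    fun l => by ring
  simp only [h, Finset.sum_add_distrib, Finset.sum_sub_distrib, ← Finset.mul_sum, ← hT,
    Finset.sum_const, Finset.card_univ, Fintype.card_fin, nsmul_eq_mul]
  field_simp
  ring

/-- **The sample variance converges at the Marcinkiewicz–Zygmund rate.**  Let `X_0, X_1, …` be
i.i.d., measurable, with `E|X_0|^{2p} < ∞` for some `1 < p < 2`.  Then
**`n^{1 − 1/p} (S²_n − Var X_0) → 0` almost surely**, where `S²_n` is the unbiased sample variance
of `X_0, …, X_{n−1}`.  [cite: Durrett2019, §2.5.1 Theorem 2.5.12 (applied to `X_i²` and to `X_i`)];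
[cite: Lemieux2009, §6.2 eq. (6.1)] -/
theorem ae_tendsto_rpow_mul_sampleVariance_sub_variance [IsProbabilityMeasure μ]
    (X : ℕ → Ω → ℝ) (hXm : ∀ n, Measurable (X n)) (hindep : iIndepFun X μ)
    (hident : ∀ n, IdentDistrib (X n) (X 0) μ μ) {p : ℝ} (hp1 : 1 < p) (hp2 : p < 2)
    (hint : Integrable (fun ω => |X 0 ω| ^ (2 * p)) μ) :
    ∀ᵐ ω ∂μ, Tendsto (fun n : ℕ => (n : ℝ) ^ (1 - 1 / p) *
      (sampleVariance (fun l : Fin n => X l) ω - variance (X 0) μ)) atTop (𝓝 0) := by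
  have hp0 : 0 < p := by linarith
  -- moments: `X_0 ∈ L^{2p} ⊂ L² ⊂ L^p` on a probability space
  have h2pE0 : ENNReal.ofReal (2 * p) ≠ 0 := by
    rw [Ne, ENNReal.ofReal_eq_zero, not_le]; linarith
  have hpE0 : ENNReal.ofReal p ≠ 0 := by
    rw [Ne, ENNReal.ofReal_eq_zero, not_le]; exact hp0
  have hL2p : MemLp (X 0) (ENNReal.ofReal (2 * p)) μ := by
    rw [← integrable_norm_rpow_iff (hXm 0).aestronglyMeasurable h2pE0 ENNReal.ofReal_ne_top,
      ENNReal.toReal_ofReal (by linarith)]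
    simpa only [Real.norm_eq_abs] using hint
  have hL2 : MemLp (X 0) 2 μ := hL2p.mono_exponent (by
    rw [show (2 : ENNReal) = ENNReal.ofReal 2 by simp]
    exact ENNReal.ofReal_le_ofReal (by linarith))
  have hLp : MemLp (X 0) (ENNReal.ofReal p) μ :=
    hL2p.mono_exponent (ENNReal.ofReal_le_ofReal (by linarith))
  have hintp : Integrable (fun ω => |X 0 ω| ^ p) μ := by
    have h := hLp
    rw [← integrable_norm_rpow_iff (hXm 0).aestronglyMeasurable hpE0 ENNReal.ofReal_ne_top,
      ENNReal.toReal_ofReal hp0.le] at h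
    simpa only [Real.norm_eq_abs] using h
  -- the squares
  set Y : ℕ → Ω → ℝ := fun n ω => X n ω ^ 2 with hY
  have hYm : ∀ n, Measurable (Y n) := fun n => (hXm n).pow_const 2
  have hYind : iIndepFun Y μ :=
    hindep.comp (fun _ (x : ℝ) => x ^ 2) fun _ => measurable_id.pow_const 2
  have hYid : ∀ n, IdentDistrib (Y n) (Y 0) μ μ := fun n =>
    (hident n).comp (measurable_id.pow_const 2)
  have hYint : Integrable (fun ω => |Y 0 ω| ^ p) μ := by
    refine hint.congr (Eventually.of_forall fun ω => ?_)
    show |X 0 ω| ^ (2 * p) = |X 0 ω ^ 2| ^ p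
    rw [abs_pow, ← Real.rpow_natCast, ← Real.rpow_mul (abs_nonneg _)]
    norm_num
  -- the two Marcinkiewicz–Zygmund rates, sample-mean form
  have hA := Durrett2019_thm_2_5_12_sampleMean Y hYm hYind hYid hp1 hp2 hYint
  have hB := Durrett2019_thm_2_5_12_sampleMean X hXm hindep hident hp1 hp2 hintp
  set m1 : ℝ := μ[X 0] with hm1
  set m2 : ℝ := μ[Y 0] with hm2
  have hvar : variance (X 0) μ = m2 - m1 ^ 2 := by
    rw [variance_eq_sub hL2]; rfl
  set r : ℝ := 1 - 1 / p with hr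
  have hr0 : 0 < r := by
    rw [hr, sub_pos, div_lt_one hp0]; exact hp1
  have hr1 : r < 1 := by
    rw [hr]; linarith [one_div_pos.mpr hp0]
  -- deterministic limits
  have hratio : Tendsto (fun n : ℕ => (n : ℝ) / ((n : ℝ) - 1)) atTop (𝓝 1) := by
    simpa [sub_eq_add_neg] using tendsto_natCast_div_add_atTop (-1 : ℝ)
  have hT3 : Tendsto (fun n : ℕ => (n : ℝ) ^ r * (m2 - m1 ^ 2) / ((n : ℝ) - 1)) atTop (𝓝 0) := by
    have h1 : Tendsto (fun n : ℕ => (n : ℝ) ^ (r - 1)) atTop (𝓝 0) := by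
      have := (tendsto_rpow_neg_atTop (by linarith : 0 < 1 - r)).comp tendsto_natCast_atTop_atTop
      refine this.congr fun n => ?_
      simp only [Function.comp_apply, neg_sub]
    have h2 := (h1.mul hratio).const_mul (m2 - m1 ^ 2)
    rw [zero_mul, mul_zero] at h2
    refine h2.congr' ?_
    filter_upwards [eventually_ge_atTop 2] with n hn
    have hn2 : (2 : ℝ) ≤ n := by exact_mod_cast hn
    have hn0 : (0 : ℝ) < n := by linarith
    have hn1 : (n : ℝ) - 1 ≠ 0 := by linarith
    rw [Real.rpow_sub hn0, Real.rpow_one]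
    field_simp
  -- assemble at a good `ω`
  filter_upwards [hA, hB] with ω hAω hBω
  have hB0 : Tendsto (fun n : ℕ => (∑ i ∈ range n, X i ω) / n - m1) atTop (𝓝 0) := by
    have h1 : Tendsto (fun n : ℕ => ((n : ℝ) ^ r)⁻¹) atTop (𝓝 0) :=
      ((tendsto_rpow_atTop hr0).comp tendsto_natCast_atTop_atTop).inv_tendsto_atTop
    have h2 := h1.mul hBω
    rw [zero_mul] at h2
    refine h2.congr' ?_
    filter_upwards [eventually_ge_atTop 1] with n hn
    have hnr : (n : ℝ) ^ r ≠ 0 := (Real.rpow_pos_of_pos (by exact_mod_cast hn) _).ne'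
    field_simp
  have hlim := ((hratio.mul hAω).sub ((hratio.mul hBω).mul (hB0.add_const (2 * m1)))).add hT3
  simp only [zero_add, mul_zero, zero_mul, sub_zero, add_zero] at hlim
  rw [hvar]
  refine hlim.congr' ?_
  filter_upwards [eventually_ge_atTop 2] with n hn
  have hn2 : (2 : ℝ) ≤ n := by exact_mod_cast hn
  have hn0 : (n : ℝ) ≠ 0 := by positivity
  have hn1 : (n : ℝ) - 1 ≠ 0 := by linarith
  rw [sampleVariance_fin_eq X (by omega) ω]
  simp only [hY]
  field_simp
  ring

end Literature.Probability.HeavyTails
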